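import Summits.HubbardSuperconductivity.HubbardSuperconductivity.Theses.ChiralWindow
import Summits.HubbardSuperconductivity.HubbardSuperconductivity.Theorems.ChiralWindowCwSsbToEvenTorusLROSplitGlue
import Literature.MathematicalPhysics.QuantumLattice.PairFieldMomentum
import HarnessLib

set_option linter.dupNamespace false

noncomputable section

namespace Summit.HubbardSuperconductivity.HubbardSuperconductivity.Theses.ChiralWindow

open scoped BigOperators Topology Manifold Classical MeasureTheory ProbabilityTheory Matrix InnerProductSpace ComplexConjugate ContinuousMap
open Filter Set Function TopologicalSpace MeasureTheory

/-- R1 construction clause (construction WITH the block term; STRATEGY-CENSUS §6 R1), as a planner would file it. -/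
def CwSlopeChiralConstruction : Prop :=
  ∃ U₀ : ℝ, 0 < U₀ ∧ ∀ U ∈ Set.Ioo (0:ℝ) U₀, ∃ δ ∈ Set.Icc (3/10 : ℝ) (12/25), ∃ μ : ℝ, (Filter.Tendsto (fun L : ℕ => ((Literature.MathematicalPhysics.QuantumLattice.hubbardTorusWith 2 (L + 1) 1 U μ).groundStateFunctional Literature.MathematicalPhysics.QuantumLattice.totalNumber).re / ((L + 1 : ℕ) : ℝ) ^ 2) Filter.atTop (nhds (1 - δ))) ∧ ∃ a : ℝ, 0 < a ∧ ∀ R : ℕ, 0 < R → ∃ κ : ℝ, 0 < κ ∧ ∀ᶠ k : ℕ in Filter.atTop, κ * a * ((2 * k + 1 + 1 : ℕ) : ℝ) ^ 2 ≤ (Literature.MathematicalPhysics.QuantumLattice.hubbardTorusWith 2 (2 * k + 1 + 1) 1 U μ + (κ : ℂ) • (((((R : ℝ) ^ 4)⁻¹ : ℝ) : ℂ) • ∑ a : Literature.Probability.LatticeModels.TorusSite 2 (2 * k + 1 + 1), (∑ u : Fin 2 → Fin R, Literature.MathematicalPhysics.QuantumLattice.localPair Literature.MathematicalPhysics.QuantumLattice.dWaveFormFactor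 (2 * k + 1 + 1) (a + fun i => ((u i : ℕ) : ZMod (2 * k + 1 + 1))))ᴴ * (∑ u : Fin 2 → Fin R, Literature.MathematicalPhysics.QuantumLattice.localPair Literature.MathematicalPhysics.QuantumLattice.dWaveFormFactor (2 * k + 1 + 1) (a + fun i => ((u i : ℕ) : ZMod (2 * k + 1 + 1)))))).groundEnergy - (Literature.MathematicalPhysics.QuantumLattice.hubbardTorusWith 2 (2 * k + 1 + 1) 1 U μ).groundEnergy

/-- unguarded weak-coupling infrared leak item. -/
def CwWeakCouplingInfraredLeak : Prop :=
  ∃ U₀ : ℝ, 0 < U₀ ∧ ∀ U ∈ Set.Ioo (0:ℝ) U₀, ∀ δ ∈ Set.Ioo (0:ℝ) (1 / 2), ∀ b : ℝ, 0 < b → ∃ η : ℝ, 0 < η ∧ ∀ᶠ k : ℕ in Filter.atTop, ∀ ψ : Literature.MathematicalPhysics.QuantumLattice.Fock (Literature.MathematicalPhysics.QuantumLattice.Orb (Literature.MathematicalPhysics.QuantumLattice.FermionTorus 2 (2 * k + 1 + 1))), Literature.MathematicalPhysics.QuantumLattice.IsGroundStateInSector (Literature.MathematicalPhysics.QuantumLattice.hubbardTorus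 2 (2 * k + 1 + 1) 1 U) (2 * ⌊(1 - δ) * ((2 * k + 1 + 1 : ℕ) : ℝ) ^ 2 / 2⌋₊) 0 ψ → star ψ ⬝ᵥ ψ = 1 → (∑ m ∈ (Finset.univ.filter fun m : Literature.Probability.LatticeModels.TorusSite 2 (2 * k + 1 + 1) => m ≠ 0 ∧ Literature.MathematicalPhysics.QuantumLattice.momentumNormSq (2 * k + 1 + 1) m < η ^ 2), Literature.MathematicalPhysics.QuantumLattice.pairStructureFactor Literature.MathematicalPhysics.QuantumLattice.dWaveFormFactor (2 * k + 1 + 1) ψ m) / ((2 * k + 1 + 1 : ℕ) : ℝ) ^ 2 ≤ b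

/-- sourced variant of the construction clause. -/
def CwRepelledChiralConstruction : Prop :=
  ∃ U₀ : ℝ, 0 < U₀ ∧ ∀ U ∈ Set.Ioo (0:ℝ) U₀, ∃ δ ∈ Set.Icc (3/10 : ℝ) (12/25), ∃ μ : ℝ, (Filter.Tendsto (fun L : ℕ => ((Literature.MathematicalPhysics.QuantumLattice.hubbardTorusWith 2 (L + 1) 1 U μ).groundStateFunctional Literature.MathematicalPhysics.QuantumLattice.totalNumber).re / ((L + 1 : ℕ) : ℝ) ^ 2) Filter.atTop (nhds (1 - δ))) ∧ ∃ a : ℝ, 0 < a ∧ ∀ R : ℕ, 0 < R → ∃ κ : ℝ, 0 < κ ∧ ∃ h₀ : ℝ, 0 < h₀ ∧ ∀ h ∈ Set.Ioo (0:ℝ) h₀, ∀ᶠ L : ℕ in Filter.atTop, a ≤ ((Literature.MathematicalPhysics.QuantumLattice.dWaveSourceTorus (L + 1) U μ h + (κ : ℂ) • (((((R : ℝ) ^ 4)⁻¹ : ℝ) : ℂ) • ∑ a : Literature.Probability.LatticeModels.TorusSite 2 (L + 1), (∑ u : Fin 2 → Fin R, Literature.MathematicalPhysics.QuantumLattice.localPair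 Literature.MathematicalPhysics.QuantumLattice.dWaveFormFactor (L + 1) (a + fun i => ((u i : ℕ) : ZMod (L + 1))))ᴴ * (∑ u : Fin 2 → Fin R, Literature.MathematicalPhysics.QuantumLattice.localPair Literature.MathematicalPhysics.QuantumLattice.dWaveFormFactor (L + 1) (a + fun i => ((u i : ℕ) : ZMod (L + 1)))))).groundStateFunctional (Literature.MathematicalPhysics.QuantumLattice.pairField Literature.MathematicalPhysics.QuantumLattice.dWaveFormFactor (L + 1))).re / ((L + 1 : ℕ) : ℝ) ^ 2

/-- rev-3 deciding theorem shape, family {slope construction, weak-coupling leak}. -/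
theorem closes3a : CwSlopeChiralConstruction → CwWeakCouplingInfraredLeak → CwKLChiralWindow → Assembly → _root_.HubbardSuperconductivity :=
  fun hC hIR _ hA => hA (Summit.HubbardSuperconductivity.HubbardSuperconductivity.Theorems.CwSsbToEvenTorusLRO.cwThesisBody_of_slopeConstruction_of_weakCouplingLeak hC hIR)

/-- family {slope construction, stmt-1089 by name}. -/
theorem closes3b : CwSlopeChiralConstruction → Summit.HubbardSuperconductivity.HubbardSuperconductivity.Theses.KacWindowPenalty.WindowInfraredBound → CwKLChiralWindow → Assembly → _root_.HubbardSuperconductivity :=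
  fun hC hW _ hA => hA (Summit.HubbardSuperconductivity.HubbardSuperconductivity.Theorems.CwSsbToEvenTorusLRO.cwThesisBody_of_slopeConstruction_of_windowInfraredBound hC hW)

/-- sourced family. -/
theorem closes3c : CwRepelledChiralConstruction → Summit.HubbardSuperconductivity.HubbardSuperconductivity.Theses.KacWindowPenalty.WindowInfraredBound → Assembly → _root_.HubbardSuperconductivity :=
  fun hC hW hA => hA (Summit.HubbardSuperconductivity.HubbardSuperconductivity.Theorems.CwSsbToEvenTorusLRO.cwThesisBody_of_repelledConstruction_of_windowInfraredBound hC hW)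

/-- and CwThesis by name. -/
example (hC : CwSlopeChiralConstruction) (hIR : CwWeakCouplingInfraredLeak) : CwThesis :=
  Summit.HubbardSuperconductivity.HubbardSuperconductivity.Theorems.CwSsbToEvenTorusLRO.cwThesisBody_of_slopeConstruction_of_weakCouplingLeak hC hIR

end Summit.HubbardSuperconductivity.HubbardSuperconductivity.Theses.ChiralWindow

end
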